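import Mathlib
import HarnessLib
import Summits.Ventures.LatticeQCDFlow.Scoring.DoeblinWindowBracket

/-!
# Window truncation under Doeblin alone: `|τ_int − τ_W(N)| ≤ (1 − ε)^{N+1}/ε` for every kernel
# minorised by its invariant law; the two-sided odd-window bracket for reversible ones

HONEST FRAMING: exact (Metropolis-corrected) sampling algorithms for lattice gauge theory;
figures of merit are autocorrelation/cost numbers at stated couplings and volumes; no
continuum-physics claim.

Venture `LatticeQCDFlow` (cell pub-lqcd), topic `Scoring`; FANOUT row 8 (`s0-cpn-nemc`, GEN-11).
NEW WORK of the cell (a geometric tail sum and a conjunction), not a published result; composes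
row 8's `Scoring/DoeblinAutocorrelation.lean` (the envelope `|ρ_t| ≤ (1 − ε)ᵗ`, no reversibility),
`Scoring/DoeblinWindowBracket.lean` (`summable_acf_of_doeblin`, `tauInt_le_window_odd_of_doeblin`)
and `Scoring/ReversibleKernelTauIntFloor.lean` (`tauIntWindow_odd_le_tauInt_of_isReversible`).
Nothing is cited as a fact.

## What is proved (`κ` Markov with invariant probability law `π` and `κ(x,·) ≥ ε π`, `ε > 0`; `f`
## bounded measurable `π`-centred; `ρ(t) = autocov κ π f t / autocov κ π f 0`)

* **`abs_tauInt_sub_tauIntWindow_le_of_doeblin`** — for EVERY such kernel (reversible or not — the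
  heat-bath sweep of `Scoring/HeatBathSweepAutocorrelation.lean` included) and every window `N`:
  `|τ_int − τ_W(N)| ≤ (1 − ε)^{N+1} / ε` (the envelope summed beyond the window; constant `C(0)`,
  weaker than the reversible bracket's `C(2m)` but sign-free).
* **`window_bracket_odd_of_isReversible`** — if moreover `κ` is `π`-reversible, for every `m`:
  `τ_W(2m+1) ≤ τ_int ≤ τ_W(2m+1) + (1/ε − 1)(1 − ε) · ρ(2m)` — a two-sided bracket from ONE odd-ended
  window of the true autocorrelation function, for HMC / Metropolis / single-site heat bath as much
  as for the flow sampler (whose even windows are brackets too, `Scoring/FlowSamplerWindowBracket.lean`).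

NOT CLAIMED: estimator noise; the automatic-window rule; any number of ours.
-/

noncomputable section

namespace Summit.Ventures.LatticeQCDFlow.Scoring

open MeasureTheory ProbabilityTheory Filter Finset Summit.Ventures.LatticeQCDFlow.Exactness
open scoped ENNReal Topology

variable {Ω : Type*} [MeasurableSpace Ω]

section Tail

variable {κ : Kernel Ω Ω} [IsMarkovKernel κ] {π : Measure Ω} [IsProbabilityMeasure π] {ε : ℝ≥0∞}

/-- **Window truncation error under Doeblin alone**: `|τ_int − τ_W(N)| ≤ (1 − ε)^{N+1}/ε` for every
bounded measurable centred observable of a Markov kernel minorised by its invariant law. -/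
theorem abs_tauInt_sub_tauIntWindow_le_of_doeblin (hinv : Kernel.Invariant κ π)
    (hmin : ∀ x {B : Set Ω}, MeasurableSet B → ε * π B ≤ κ x B) (hε0 : 0 < ε) {f : Ω → ℝ}
    (hf : Measurable f) {C : ℝ} (hC : ∀ x, |f x| ≤ C) (hf0 : ∫ x, f x ∂π = 0) (N : ℕ) :
    |tauInt (fun t => autocov κ π f t / autocov κ π f 0)
        - tauIntWindow (fun t => autocov κ π f t / autocov κ π f 0) N|
      ≤ (1 - ε.toReal) ^ (N + 1) / ε.toReal := by
  set ρ : ℕ → ℝ := fun t => autocov κ π f t / autocov κ π f 0 with hρ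
  have hs : Summable fun t => ρ (t + 1) := summable_acf_of_doeblin hinv hmin hε0 hf hC hf0
  have henv : ∀ t, |ρ t| ≤ (1 - ε.toReal) ^ t := fun t => abs_acf_le_of_doeblin hinv hmin hf hC hf0 t
  have hε1 := eps_le_one_of_doeblin hmin
  have hεr0 : 0 < ε.toReal :=
    ENNReal.toReal_pos hε0.ne' (ne_top_of_le_ne_top ENNReal.one_ne_top hε1)
  have hl0 : 0 ≤ 1 - ε.toReal := one_sub_toReal_nonneg_of_doeblin hmin
  have hl1 : 1 - ε.toReal < 1 := by linarith
  -- the tail beyond the window and its geometric majorant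
  have htail_s : Summable fun s : ℕ => ρ (s + N + 1) := (summable_nat_add_iff N).2 hs
  have hgeo : HasSum (fun s : ℕ => (1 - ε.toReal) ^ (N + 1) * (1 - ε.toReal) ^ s)
      ((1 - ε.toReal) ^ (N + 1) * (1 - (1 - ε.toReal))⁻¹) :=
    (hasSum_geometric_of_lt_one hl0 hl1).mul_left _
  have hG : (1 - ε.toReal) ^ (N + 1) * (1 - (1 - ε.toReal))⁻¹ = (1 - ε.toReal) ^ (N + 1) / ε.toReal := by
    rw [sub_sub_cancel, div_eq_mul_inv]
  have hb : ∀ s : ℕ, |ρ (s + N + 1)| ≤ (1 - ε.toReal) ^ (N + 1) * (1 - ε.toReal) ^ s := fun s => by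
    rw [← pow_add, show N + 1 + s = s + N + 1 by ring]; exact henv _
  have hup : ∑' s : ℕ, ρ (s + N + 1) ≤ (1 - ε.toReal) ^ (N + 1) / ε.toReal := by
    rw [← hG, ← hgeo.tsum_eq]
    exact htail_s.tsum_le_tsum (fun s => (le_abs_self _).trans (hb s)) hgeo.summable
  have hlo : -((1 - ε.toReal) ^ (N + 1) / ε.toReal) ≤ ∑' s : ℕ, ρ (s + N + 1) := by
    rw [← hG, ← hgeo.tsum_eq, ← tsum_neg]
    exact hgeo.summable.neg.tsum_le_tsum (fun s => (neg_le.1 ((neg_le_abs _).trans (hb s))))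
      htail_s
  have hsplit : ∑' t, ρ (t + 1) = ∑ t ∈ Finset.range N, ρ (t + 1) + ∑' s, ρ (s + N + 1) :=
    (hs.sum_add_tsum_nat_add N).symm
  have e : tauInt ρ - tauIntWindow ρ N = ∑' s, ρ (s + N + 1) := by
    unfold tauInt tauIntWindow; rw [hsplit]; ring
  rw [e]
  exact abs_le.2 ⟨hlo, hup⟩

/-- **Two-sided odd-window bracket for every reversible kernel with a Doeblin constant**:
`τ_W(2m+1) ≤ τ_int ≤ τ_W(2m+1) + (1/ε − 1)(1 − ε)·ρ(2m)`. -/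
theorem window_bracket_odd_of_isReversible (hrev : Kernel.IsReversible κ π)
    (hmin : ∀ x {B : Set Ω}, MeasurableSet B → ε * π B ≤ κ x B) (hε0 : 0 < ε) {f : Ω → ℝ}
    (hf : Measurable f) {C : ℝ} (hC : ∀ x, |f x| ≤ C) (hf0 : ∫ x, f x ∂π = 0) (m : ℕ) :
    tauIntWindow (fun t => autocov κ π f t / autocov κ π f 0) (2 * m + 1)
        ≤ tauInt (fun t => autocov κ π f t / autocov κ π f 0) ∧
      tauInt (fun t => autocov κ π f t / autocov κ π f 0)
        ≤ tauIntWindow (fun t => autocov κ π f t / autocov κ π f 0) (2 * m + 1)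
          + (1 / ε.toReal - 1) * (1 - ε.toReal) * (autocov κ π f (2 * m) / autocov κ π f 0) :=
  ⟨tauIntWindow_odd_le_tauInt_of_isReversible hrev hf hC
      (summable_acf_of_doeblin hrev.invariant hmin hε0 hf hC hf0) m,
    tauInt_le_window_odd_of_doeblin hrev hmin hε0 hf hC hf0 m⟩

end Tail

end Summit.Ventures.LatticeQCDFlow.Scoring

end
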